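import Literature.Topology.FourManifolds.PolarGraphTwist
import Literature.Topology.FourManifolds.PlanarArch
import HarnessLib

/-!
# The twisted height along a slice curve: derivative, sign criteria, and bounds for the twist angle

Topic `Literature/Topology/FourManifolds`; fact seat `provefact-IsStrictHandleSlide.isSurgery`
(R. C. Kirby, *The Topology of 4-Manifolds*, LNM 1374 (1989), Ch. I §4; remaining content: the
named fact (S) `Literature.Topology.FourManifolds.FramedLink.IsStrictHandleSlide.slideModel`).
The sweep of the slid attaching circle across the meridian disc of the surgered tube
(`SlideSweep.exists_planarSweep`, `KirbyMovesSlideSweepExchange2.lean`) is a horizontal push in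
the twisted chart `Λ` of the slice plane, between two curves which must be graphs over the twisted
height `y = r sin α`, `α = twistAngle c r θ` (`TwistCoords.lean`). `PolarGraphTwist.lean` treats
polar graphs `r = ρ(θ)`; the route of the slid circle (tip, turn, landing on the push-off, long arc)
is a general slice curve `t ↦ (r t, θ t)`. This file provides, for such a curve:

* `twistQ c r θ = ∂α/∂θ = E/(cos²(θ/2) + E² sin²(θ/2))` (`E = e^{cr}`), positive;
* `hasDerivAt_twistAngle_curve`: `α̇ = c sin α ṙ + twistQ θ̇`; `hasDerivAt_curveY`:
  `ẏ = ṙ sin α (1 + r c cos α) + r cos α twistQ θ̇`;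
* **sign criteria** for `ẏ < 0`: `deriv_curveY_neg_of_phase1` (`ṙ < 0`, `θ̇ ≤ 0`, `cos α ≥ 0`: the
  route just after the tip), `deriv_curveY_neg_of_phase2` (`ṙ ≤ 0`, `θ̇ ≥ 0`, `α` within
  `1/(2rc)` of the vertical in cosine, and the mixed-term inequality: the turn), and
  `deriv_curveY_neg_of_landed` (`ṙ ≤ 0`, `θ̇ > 0`, `cos α < 0`, `1 + rc cos α ≥ 0`: the landing and
  the long arc);
* **a priori bounds for `α` along the curve** by monotone comparison functions:
  `twistAngle_curve_ge` (`α t ≥ α t₁ + c (r t - r t₁) + q_min (θ t - θ t₁)` when `ṙ ≤ 0 ≤ θ̇`),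
  `twistAngle_curve_le` (`α t ≤ α t₁ + q_max (θ t - θ t₁)`), `twistAngle_curve_antitone`
  (`α` non-increasing when `ṙ ≤ 0`, `θ̇ ≤ 0`).

Everything is elementary calculus; no definitions beyond `twistQ`, no named facts.

## References

* R. C. Kirby, *The Topology of 4-Manifolds*, LNM 1374, Springer (1989), Ch. I §4. [Kirby1989]
-/

open scoped Topology
open Set Real Filter

noncomputable section

namespace Literature.Topology.FourManifolds

/-! ### `∂α/∂θ` -/

/-- **`twistQ c r θ = ∂α/∂θ`** `= e^{cr} / (cos² (θ/2) + e^{2cr} sin² (θ/2))`. [folklore] -/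
def twistQ (c r θ : ℝ) : ℝ := exp (c * r) / (cos (θ / 2) ^ 2 + exp (c * r) ^ 2 * sin (θ / 2) ^ 2)

/-- `twistQ_def` (auxiliary). [folklore] -/
theorem twistQ_def (c r θ : ℝ) : twistQ c r θ = exp (c * r) / (cos (θ / 2) ^ 2 + exp (c * r) ^ 2 * sin (θ / 2) ^ 2) := rfl

/-- `twistQ > 0` for `θ ∈ (-π, π)`. [folklore] -/
theorem twistQ_pos (c r : ℝ) {θ : ℝ} (hθ : θ ∈ Ioo (-π) π) : 0 < twistQ c r θ := by
  have hc : 0 < cos (θ / 2) := cos_pos_of_mem_Ioo ⟨by linarith [hθ.1], by linarith [hθ.2]⟩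
  have hE : 0 < exp (c * r) := exp_pos _
  unfold twistQ; positivity

/-- `twistQ` is the `θ`-derivative of the twist angle. [folklore] -/
theorem deriv_twistAngle_theta_eq (c r : ℝ) {θ : ℝ} (hθ : θ ∈ Ioo (-π) π) :
    deriv (twistAngle c r) θ = twistQ c r θ := (hasDerivAt_twistAngle_theta c r hθ).deriv

/-- `twistQ` is continuous on `ℝ × ℝ × (-π, π)` in `(r, θ)` (for fixed `c`). [folklore] -/
theorem continuousOn_twistQ (c : ℝ) : ContinuousOn (fun p : ℝ × ℝ ↦ twistQ c p.1 p.2) (univ ×ˢ Ioo (-π) π) := by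
  unfold twistQ
  refine ContinuousOn.div ?_ ?_ ?_
  · exact (continuous_exp.comp (continuous_const.mul continuous_fst)).continuousOn
  · exact (((continuous_cos.comp (continuous_snd.div_const 2)).pow 2).add
      (((continuous_exp.comp (continuous_const.mul continuous_fst)).pow 2).mul
        ((continuous_sin.comp (continuous_snd.div_const 2)).pow 2))).continuousOn
  · intro p hp
    have hp2 : p.2 ∈ Ioo (-π) π := hp.2
    have hc : 0 < cos (p.2 / 2) := cos_pos_of_mem_Ioo ⟨by linarith [hp2.1], by linarith [hp2.2]⟩
    positivity

/-! ### Derivatives along a slice curve -/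

/-- **The twist angle along a curve**: `d/dt twistAngle c (r t) (θ t) = c sin α · ṙ + twistQ · θ̇`.
[folklore] -/
theorem hasDerivAt_twistAngle_curve (c : ℝ) {r θ : ℝ → ℝ} {r' θ' t : ℝ} (hr : HasDerivAt r r' t)
    (hθ : HasDerivAt θ θ' t) (hθt : θ t ∈ Ioo (-π) π) :
    HasDerivAt (fun t ↦ twistAngle c (r t) (θ t))
      (c * sin (twistAngle c (r t) (θ t)) * r' + twistQ c (r t) (θ t) * θ') t := by
  have hc : 0 < cos (θ t / 2) := cos_pos_of_mem_Ioo ⟨by linarith [hθt.1], by linarith [hθt.2]⟩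
  have hEp : 0 < exp (c * r t) := exp_pos _
  have hexp : HasDerivAt (fun t ↦ exp (c * r t)) (exp (c * r t) * (c * r')) t := (hr.const_mul c).exp
  have hθ2 : HasDerivAt (fun t ↦ θ t / 2) (θ' / 2) t := hθ.div_const 2
  have htan := (hasDerivAt_tan hc.ne').comp t hθ2
  have hprod := hexp.mul htan
  have ha := ((hasDerivAt_arctan (exp (c * r t) * tan (θ t / 2))).comp t hprod).const_mul 2
  refine (ha.congr_of_eventuallyEq (Eventually.of_forall fun x ↦ rfl)).congr_deriv ?_
  simp only [Function.comp_def]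
  rw [sin_twistAngle_eq, twistQ, tan_eq_sin_div_cos]
  have hc2 : cos (θ t / 2) ≠ 0 := hc.ne'
  have hden : cos (θ t / 2) ^ 2 + exp (c * r t) ^ 2 * sin (θ t / 2) ^ 2 ≠ 0 := by positivity
  field_simp

/-- **The twisted height along a curve**, `y t = r t · sin α t`:
`ẏ = ṙ sin α + r cos α (c sin α ṙ + twistQ θ̇)`. [folklore] -/
theorem hasDerivAt_curveY (c : ℝ) {r θ : ℝ → ℝ} {r' θ' t : ℝ} (hr : HasDerivAt r r' t)
    (hθ : HasDerivAt θ θ' t) (hθt : θ t ∈ Ioo (-π) π) :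
    HasDerivAt (fun t ↦ r t * sin (twistAngle c (r t) (θ t)))
      (r' * sin (twistAngle c (r t) (θ t)) +
        r t * (cos (twistAngle c (r t) (θ t)) *
          (c * sin (twistAngle c (r t) (θ t)) * r' + twistQ c (r t) (θ t) * θ'))) t :=
  hr.mul (hasDerivAt_twistAngle_curve c hr hθ hθt).sin

/-- The twisted first coordinate along a curve, `x t = r t · cos α t`. [folklore] -/
theorem hasDerivAt_curveX (c : ℝ) {r θ : ℝ → ℝ} {r' θ' t : ℝ} (hr : HasDerivAt r r' t)
    (hθ : HasDerivAt θ θ' t) (hθt : θ t ∈ Ioo (-π) π) :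
    HasDerivAt (fun t ↦ r t * cos (twistAngle c (r t) (θ t)))
      (r' * cos (twistAngle c (r t) (θ t)) +
        r t * (-sin (twistAngle c (r t) (θ t)) *
          (c * sin (twistAngle c (r t) (θ t)) * r' + twistQ c (r t) (θ t) * θ'))) t :=
  hr.mul (hasDerivAt_twistAngle_curve c hr hθ hθt).cos

/-! ### Sign criteria for `ẏ < 0` -/

section Sign

variable {c R r' θ' α q : ℝ}

/-- The algebraic identity behind the criteria:
`ṙ sin α + r cos α (c sin α ṙ + q θ̇) = ṙ sin α (1 + r c cos α) + r cos α q θ̇`. [folklore] -/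
theorem curveY_deriv_eq : r' * sin α + R * (cos α * (c * sin α * r' + q * θ')) =
    r' * sin α * (1 + R * c * cos α) + R * cos α * q * θ' := by ring

/-- **Phase 1** (just after the tip: radius decreasing, angle non-increasing, right of the vertical):
`ṙ < 0`, `θ̇ ≤ 0`, `cos α ≥ 0`, `sin α > 0`, `r > 0`, `c ≥ 0`, `q ≥ 0` give `ẏ < 0`. [folklore] -/
theorem curveY_deriv_neg_of_phase1 (hc : 0 ≤ c) (hR : 0 < R) (hr : r' < 0) (hθ : θ' ≤ 0)
    (hcos : 0 ≤ cos α) (hsin : 0 < sin α) (hq : 0 ≤ q) :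
    r' * sin α + R * (cos α * (c * sin α * r' + q * θ')) < 0 := by
  rw [curveY_deriv_eq]
  have h1 : r' * sin α < 0 := mul_neg_of_neg_of_pos hr hsin
  have h2 : 0 ≤ R * c * cos α := by positivity
  have h3 : R * cos α * q * θ' ≤ 0 := mul_nonpos_of_nonneg_of_nonpos (by positivity) hθ
  nlinarith

/-- **Phase 2** (the turn: radius non-increasing, angle non-decreasing, `α` near the vertical): if
`cos α ≤ s₀` with `s₀ ≥ 0`, `R c cos α ≥ -1/2`, and the mixed-term inequality
`R q θ̇ s₀ < -ṙ sin α` holds (in particular `ṙ < 0`), then `ẏ < 0`. [folklore] -/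
theorem curveY_deriv_neg_of_phase2 (hc : 0 ≤ c) (hR : 0 < R) (hr : r' ≤ 0) (hθ : 0 ≤ θ')
    (hsin : 0 < sin α) (hq : 0 ≤ q) {s₀ : ℝ} (hs₀ : 0 ≤ s₀) (hcos : cos α ≤ s₀)
    (hband : -1 / 2 ≤ R * c * cos α) (hmix : R * q * θ' * s₀ < -r' * sin α) :
    r' * sin α + R * (cos α * (c * sin α * r' + q * θ')) < 0 := by
  rw [curveY_deriv_eq]
  have h0 : r' * sin α ≤ 0 := mul_nonpos_of_nonpos_of_nonneg hr hsin.le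
  rcases le_or_gt (cos α) 0 with hca | hca
  · -- left of the vertical: the mixed term helps, the radial term is negative
    have h2 : R * cos α * q * θ' ≤ 0 := by
      have : R * cos α ≤ 0 := mul_nonpos_of_nonneg_of_nonpos hR.le hca
      exact mul_nonpos_of_nonpos_of_nonneg (mul_nonpos_of_nonpos_of_nonneg this hq) hθ
    have h3 : 0 < -r' * sin α := lt_of_le_of_lt (by positivity) hmix
    have h4 : 1 / 2 ≤ 1 + R * c * cos α := by linarith
    have h5 : r' * sin α * (1 + R * c * cos α) ≤ r' * sin α * (1 / 2) := mul_le_mul_of_nonpos_left h4 h0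
    nlinarith
  · -- right of the vertical: the radial term is ≤ `ṙ sin α`, the mixed term is controlled by `hmix`
    have h2 : R * cos α * q * θ' ≤ R * q * θ' * s₀ := by
      have : R * cos α * q * θ' = (R * q * θ') * cos α := by ring
      rw [this]
      exact mul_le_mul_of_nonneg_left hcos (by positivity)
    have h3 : r' * sin α * (1 + R * c * cos α) ≤ r' * sin α := by
      have : 0 ≤ R * c * cos α := by positivity
      nlinarith
    nlinarith

/-- **Landed** (on the push-off, or more generally wherever `ṙ ≤ 0`, `θ̇ > 0`, `cos α < 0`,
`1 + R c cos α ≥ 0`): `ẏ < 0`. [folklore] -/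
theorem curveY_deriv_neg_of_landed (hR : 0 < R) (hr : r' ≤ 0) (hθ : 0 < θ') (hsin : 0 ≤ sin α)
    (hcos : cos α < 0) (hq : 0 < q) (hband : 0 ≤ 1 + R * c * cos α) :
    r' * sin α + R * (cos α * (c * sin α * r' + q * θ')) < 0 := by
  rw [curveY_deriv_eq]
  have h1 : r' * sin α * (1 + R * c * cos α) ≤ 0 :=
    mul_nonpos_of_nonpos_of_nonneg (mul_nonpos_of_nonpos_of_nonneg hr hsin) hband
  have h2 : R * cos α * q * θ' < 0 := by
    have : R * cos α < 0 := mul_neg_of_pos_of_neg hR hcos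
    exact mul_neg_of_neg_of_pos (mul_neg_of_neg_of_pos this hq) hθ
  linarith

end Sign

/-! ### A priori bounds for the twist angle along a curve -/

section Bounds

variable {c : ℝ} {r θ dr dθ : ℝ → ℝ} {t₁ t₂ : ℝ}

/-- **Lower comparison.** On `[t₁, t₂]` let `ṙ ≤ 0 ≤ θ̇`, `θ ∈ (-π, π)` and `twistQ ≥ q_min`, `c ≥ 0`.
Then `α t ≥ α t₁ + c (r t - r t₁) + q_min (θ t - θ t₁)`. [folklore] -/
theorem twistAngle_curve_ge (hc : 0 ≤ c) (ht : t₁ ≤ t₂)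
    (hr : ∀ t ∈ Icc t₁ t₂, HasDerivAt r (dr t) t) (hθ : ∀ t ∈ Icc t₁ t₂, HasDerivAt θ (dθ t) t)
    (hθm : ∀ t ∈ Icc t₁ t₂, θ t ∈ Ioo (-π) π) (hdr : ∀ t ∈ Icc t₁ t₂, dr t ≤ 0)
    (hdθ : ∀ t ∈ Icc t₁ t₂, 0 ≤ dθ t) {qmin : ℝ} (hq : ∀ t ∈ Icc t₁ t₂, qmin ≤ twistQ c (r t) (θ t))
    {t : ℝ} (htt : t ∈ Icc t₁ t₂) :
    twistAngle c (r t₁) (θ t₁) + c * (r t - r t₁) + qmin * (θ t - θ t₁) ≤ twistAngle c (r t) (θ t) := by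
  -- `ψ = α - c r - qmin θ` is non-decreasing
  set ψ : ℝ → ℝ := fun s ↦ twistAngle c (r s) (θ s) - c * r s - qmin * θ s with hψ
  have hψd : ∀ s ∈ Icc t₁ t₂, HasDerivAt ψ
      ((c * sin (twistAngle c (r s) (θ s)) * dr s + twistQ c (r s) (θ s) * dθ s) - c * dr s - qmin * dθ s) s :=
    fun s hs ↦ ((hasDerivAt_twistAngle_curve c (hr s hs) (hθ s hs) (hθm s hs)).sub ((hr s hs).const_mul c)).sub
      ((hθ s hs).const_mul qmin)
  have hmono : MonotoneOn ψ (Icc t₁ t₂) := by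
    refine monotoneOn_of_deriv_nonneg (convex_Icc _ _) ?_ ?_ ?_
    · exact fun s hs ↦ (hψd s hs).continuousAt.continuousWithinAt
    · intro s hs
      rw [interior_Icc] at hs
      exact (hψd s (Ioo_subset_Icc_self hs)).differentiableAt.differentiableWithinAt
    · intro s hs
      rw [interior_Icc] at hs
      have hs' := Ioo_subset_Icc_self hs
      rw [(hψd s hs').deriv]
      have h1 : sin (twistAngle c (r s) (θ s)) ≤ 1 := sin_le_one _
      have h2 := hdr s hs'; have h3 := hdθ s hs'; have h4 := hq s hs'
      nlinarith [mul_nonneg hc (mul_nonneg (sub_nonneg.2 h1) (neg_nonneg.2 h2)),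
        mul_nonneg (sub_nonneg.2 h4) h3]
  have := hmono ⟨le_rfl, ht⟩ htt htt.1
  simp only [hψ] at this
  linarith

/-- **Upper comparison.** On `[t₁, t₂]` let `ṙ ≤ 0`, `θ̇ ≥ 0`, `θ ∈ [0, π)`, `twistQ ≤ q_max`, `c ≥ 0`.
Then `α t ≤ α t₁ + q_max (θ t - θ t₁)`. [folklore] -/
theorem twistAngle_curve_le (hc : 0 ≤ c) (ht : t₁ ≤ t₂)
    (hr : ∀ t ∈ Icc t₁ t₂, HasDerivAt r (dr t) t) (hθ : ∀ t ∈ Icc t₁ t₂, HasDerivAt θ (dθ t) t)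
    (hθm : ∀ t ∈ Icc t₁ t₂, θ t ∈ Ico 0 π) (hdr : ∀ t ∈ Icc t₁ t₂, dr t ≤ 0)
    (hdθ : ∀ t ∈ Icc t₁ t₂, 0 ≤ dθ t) {qmax : ℝ} (hq : ∀ t ∈ Icc t₁ t₂, twistQ c (r t) (θ t) ≤ qmax)
    {t : ℝ} (htt : t ∈ Icc t₁ t₂) :
    twistAngle c (r t) (θ t) ≤ twistAngle c (r t₁) (θ t₁) + qmax * (θ t - θ t₁) := by
  have hθm' : ∀ t ∈ Icc t₁ t₂, θ t ∈ Ioo (-π) π := fun s hs ↦ ⟨by linarith [(hθm s hs).1, pi_pos], (hθm s hs).2⟩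
  set ψ : ℝ → ℝ := fun s ↦ twistAngle c (r s) (θ s) - qmax * θ s with hψ
  have hψd : ∀ s ∈ Icc t₁ t₂, HasDerivAt ψ
      ((c * sin (twistAngle c (r s) (θ s)) * dr s + twistQ c (r s) (θ s) * dθ s) - qmax * dθ s) s :=
    fun s hs ↦ (hasDerivAt_twistAngle_curve c (hr s hs) (hθ s hs) (hθm' s hs)).sub ((hθ s hs).const_mul qmax)
  have hanti : AntitoneOn ψ (Icc t₁ t₂) := by
    refine antitoneOn_of_deriv_nonpos (convex_Icc _ _) ?_ ?_ ?_
    · exact fun s hs ↦ (hψd s hs).continuousAt.continuousWithinAt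
    · intro s hs
      rw [interior_Icc] at hs
      exact (hψd s (Ioo_subset_Icc_self hs)).differentiableAt.differentiableWithinAt
    · intro s hs
      rw [interior_Icc] at hs
      have hs' := Ioo_subset_Icc_self hs
      rw [(hψd s hs').deriv]
      -- `sin α ≥ 0` since `α ∈ [0, π)` for `θ ∈ [0, π)`
      have h1 : 0 ≤ sin (twistAngle c (r s) (θ s)) := by
        have hα := twistAngle_mem_Ioo c (r s) (θ s)
        rcases (hθm s hs').1.eq_or_lt with h0 | h0
        · rw [← h0, twistAngle_zero, sin_zero]
        · exact sin_nonneg_of_nonneg_of_le_pi (twistAngle_pos c (r s) ⟨h0, (hθm s hs').2⟩).le hα.2.le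
      have h2 := hdr s hs'; have h3 := hdθ s hs'; have h4 := hq s hs'
      nlinarith [mul_nonneg (mul_nonneg hc h1) (neg_nonneg.2 h2), mul_nonneg (sub_nonneg.2 h4) h3]
  have := hanti ⟨le_rfl, ht⟩ htt htt.1
  simp only [hψ] at this
  linarith

/-- **After the tip** (`ṙ ≤ 0`, `θ̇ ≤ 0`, `θ ∈ [0, π)`, `c ≥ 0`) the twist angle is non-increasing
along the curve. [folklore] -/
theorem twistAngle_curve_antitone (hc : 0 ≤ c)
    (hr : ∀ t ∈ Icc t₁ t₂, HasDerivAt r (dr t) t) (hθ : ∀ t ∈ Icc t₁ t₂, HasDerivAt θ (dθ t) t)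
    (hθm : ∀ t ∈ Icc t₁ t₂, θ t ∈ Ico 0 π) (hdr : ∀ t ∈ Icc t₁ t₂, dr t ≤ 0)
    (hdθ : ∀ t ∈ Icc t₁ t₂, dθ t ≤ 0) :
    AntitoneOn (fun t ↦ twistAngle c (r t) (θ t)) (Icc t₁ t₂) := by
  have hθm' : ∀ t ∈ Icc t₁ t₂, θ t ∈ Ioo (-π) π := fun s hs ↦ ⟨by linarith [(hθm s hs).1, pi_pos], (hθm s hs).2⟩
  have hd : ∀ s ∈ Icc t₁ t₂, HasDerivAt (fun t ↦ twistAngle c (r t) (θ t))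
      (c * sin (twistAngle c (r s) (θ s)) * dr s + twistQ c (r s) (θ s) * dθ s) s :=
    fun s hs ↦ hasDerivAt_twistAngle_curve c (hr s hs) (hθ s hs) (hθm' s hs)
  refine antitoneOn_of_deriv_nonpos (convex_Icc _ _) ?_ ?_ ?_
  · exact fun s hs ↦ (hd s hs).continuousAt.continuousWithinAt
  · intro s hs
    rw [interior_Icc] at hs
    exact (hd s (Ioo_subset_Icc_self hs)).differentiableAt.differentiableWithinAt
  · intro s hs
    rw [interior_Icc] at hs
    have hs' := Ioo_subset_Icc_self hs
    rw [(hd s hs').deriv]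
    have h1 : 0 ≤ sin (twistAngle c (r s) (θ s)) := by
      have hα := twistAngle_mem_Ioo c (r s) (θ s)
      rcases (hθm s hs').1.eq_or_lt with h0 | h0
      · rw [← h0, twistAngle_zero, sin_zero]
      · exact sin_nonneg_of_nonneg_of_le_pi (twistAngle_pos c (r s) ⟨h0, (hθm s hs').2⟩).le hα.2.le
    have hq := (twistQ_pos c (r s) (hθm' s hs')).le
    nlinarith [mul_nonneg (mul_nonneg hc h1) (neg_nonneg.2 (hdr s hs')), mul_nonneg hq (neg_nonneg.2 (hdθ s hs'))]

/-- Lower comparison after the tip (`θ̇ ≤ 0`): `α t ≥ α t₁ + c (r t - r t₁) + q_max (θ t - θ t₁)`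
(here `θ t - θ t₁ ≤ 0`). [folklore] -/
theorem twistAngle_curve_ge' (hc : 0 ≤ c) (ht : t₁ ≤ t₂)
    (hr : ∀ t ∈ Icc t₁ t₂, HasDerivAt r (dr t) t) (hθ : ∀ t ∈ Icc t₁ t₂, HasDerivAt θ (dθ t) t)
    (hθm : ∀ t ∈ Icc t₁ t₂, θ t ∈ Ioo (-π) π) (hdr : ∀ t ∈ Icc t₁ t₂, dr t ≤ 0)
    (hdθ : ∀ t ∈ Icc t₁ t₂, dθ t ≤ 0) {qmax : ℝ} (hq : ∀ t ∈ Icc t₁ t₂, twistQ c (r t) (θ t) ≤ qmax)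
    {t : ℝ} (htt : t ∈ Icc t₁ t₂) :
    twistAngle c (r t₁) (θ t₁) + c * (r t - r t₁) + qmax * (θ t - θ t₁) ≤ twistAngle c (r t) (θ t) := by
  set ψ : ℝ → ℝ := fun s ↦ twistAngle c (r s) (θ s) - c * r s - qmax * θ s with hψ
  have hψd : ∀ s ∈ Icc t₁ t₂, HasDerivAt ψ
      ((c * sin (twistAngle c (r s) (θ s)) * dr s + twistQ c (r s) (θ s) * dθ s) - c * dr s - qmax * dθ s) s :=
    fun s hs ↦ ((hasDerivAt_twistAngle_curve c (hr s hs) (hθ s hs) (hθm s hs)).sub ((hr s hs).const_mul c)).sub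
      ((hθ s hs).const_mul qmax)
  have hmono : MonotoneOn ψ (Icc t₁ t₂) := by
    refine monotoneOn_of_deriv_nonneg (convex_Icc _ _) ?_ ?_ ?_
    · exact fun s hs ↦ (hψd s hs).continuousAt.continuousWithinAt
    · intro s hs
      rw [interior_Icc] at hs
      exact (hψd s (Ioo_subset_Icc_self hs)).differentiableAt.differentiableWithinAt
    · intro s hs
      rw [interior_Icc] at hs
      have hs' := Ioo_subset_Icc_self hs
      rw [(hψd s hs').deriv]
      have h1 : sin (twistAngle c (r s) (θ s)) ≤ 1 := sin_le_one _
      have h2 := hdr s hs'; have h3 := hdθ s hs'; have h4 := hq s hs'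
      nlinarith [mul_nonneg hc (mul_nonneg (sub_nonneg.2 h1) (neg_nonneg.2 h2)),
        mul_nonneg (sub_nonneg.2 h4) (neg_nonneg.2 h3)]
  have := hmono ⟨le_rfl, ht⟩ htt htt.1
  simp only [hψ] at this
  linarith

end Bounds

end Literature.Topology.FourManifolds
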